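import Summits.ValiantsHypothesis.ValiantsHypothesis.Theorems.KPlusLogSqLawTropicalGradedWalkChainTwoDefs

/-!
# Route «KPlusLogSqLaw» — GRW-lite (all-`m` `K = 4` family): the FULL chain (phases `1 ≤ w ≤ m`), definitions

HONEST FRAMING.  Definitions-only file (D-0009) of the helper chain `--supports` the crux
`Summit.ValiantsHypothesis.ValiantsHypothesis.Theses.KPlusLogSqLaw.TropicalB` (item `stmt-ValiantsHypothesis-19771`, route `KPlusLogSqLaw`;
cell `pub-symmetroid`, seat val-sym-trop-p3 g15, 2026-08-29), on top of `…TropicalGradedWalkChainTwoDefs.lean`.  Bookkeeping functions only;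
nothing is proved here and nothing bears on `TropicalB`, `WeakLifting`, `MatrixDescartes` or `VP ≠ VNP`.

CONTENT.  The chain of ALL states of the GRW-lite design of `…TropicalGradedWalkDefs` from `D(1,0,0)` to `T(m,m,m)`, `m = n + 1`, in slope
order: the chain `nxt2` of `…ChainTwoDefs` over the phases `w ≤ n`, followed by the last phase `m` — for every `u < m` the deep walk
`(m,u,0), (m,u,1), …, (m,u,u)`, then the top states `(m,m,0), …, (m,m,m)`.  `nxtM` = successor inside phase `m`, `nxt3 n` = successor of the
full chain, `seqR3 n k` = `k`-th state, `ValidM n` / `ValidR3 n` = the phase-`m` states / all states, `posRM` = position inside phase `m`,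
`idxR3 n` = rank, `lenR3 n = offP2 (n+1) + (n+1)(n+2)/2 + (n+1)` = rank of the last state (`= 2m²`, proved in `…GradedWalkChainThree.lean`).
-/

set_option linter.dupNamespace false
set_option autoImplicit false

namespace Summit.ValiantsHypothesis.ValiantsHypothesis.Theorems.LacunarySymmetroidMatrixDescartes.TropicalCensus

namespace GradedWalk

/-- successor of a state `(m, u, t)` inside the last phase: one step deeper, or the next walk, or the next top state. -/
def nxtM (s : ℕ × ℕ × ℕ) : ℕ × ℕ × ℕ :=
  if s.2.1 < s.1 then (if s.2.2 < s.2.1 then (s.1, s.2.1, s.2.2 + 1) else (s.1, s.2.1 + 1, 0))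
  else (if s.2.2 < s.1 then (s.1, s.1, s.2.2 + 1) else (s.1 + 1, 0, 0))

/-- successor in the full chain for `m = n + 1`: `nxt2` in the phases `w ≤ n`, `nxtM` in phase `m`. -/
def nxt3 (n : ℕ) (s : ℕ × ℕ × ℕ) : ℕ × ℕ × ℕ := if s.1 ≤ n then nxt2 s else nxtM s

/-- the `k`-th state of the full chain (starting at `D(1,0,0)`). -/
def seqR3 (n k : ℕ) : ℕ × ℕ × ℕ := (nxt3 n)^[k] (1, 0, 0)

/-- the states of the last phase `m = n + 1`: `(m, u, t)` with `t ≤ u < m`, and the tops `(m, m, t)` with `t ≤ m`. -/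
def ValidM (n : ℕ) (s : ℕ × ℕ × ℕ) : Prop :=
  s.1 = n + 1 ∧ ((s.2.1 < n + 1 ∧ s.2.2 ≤ s.2.1) ∨ (s.2.1 = n + 1 ∧ s.2.2 ≤ n + 1))

/-- the states of the full chain. -/
def ValidR3 (n : ℕ) (s : ℕ × ℕ × ℕ) : Prop := (s.1 ≤ n ∧ ValidR2 s) ∨ ValidM n s

/-- position of a state inside the last phase: the walks before `u` have `1 + 2 + ⋯ + u` states. -/
def posRM (s : ℕ × ℕ × ℕ) : ℕ := s.2.1 * (s.2.1 + 1) / 2 + s.2.2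

/-- rank of a state in the full chain. -/
def idxR3 (n : ℕ) (s : ℕ × ℕ × ℕ) : ℕ := if s.1 ≤ n then idxR2 s else offP2 (n + 1) + posRM s

/-- rank of the last state `T(m,m,m)`: the full chain has `lenR3 n + 1` states. -/
def lenR3 (n : ℕ) : ℕ := offP2 (n + 1) + (n + 1) * (n + 2) / 2 + (n + 1)

end GradedWalk

end Summit.ValiantsHypothesis.ValiantsHypothesis.Theorems.LacunarySymmetroidMatrixDescartes.TropicalCensus
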